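/-
Copyright: lit-balaban Phase-2 proof seat p34 (gen 16).  Statement-level skeleton of a published paper; no proof claims beyond what the
kernel checks below.
-/
import Literature.MathematicalPhysics.QuantumFieldTheory.BalabanImbrieJaffe1984to88.BIJ88NeumannPropagatorSmallFieldRegion
import Literature.MathematicalPhysics.QuantumFieldTheory.BalabanImbrieJaffe1984to88.BIJ85CentredAxialGauge
import Literature.MathematicalPhysics.QuantumFieldTheory.BalabanImbrieJaffe1984to88.BIJ85HolonomyDeviation
import Literature.MathematicalPhysics.QuantumFieldTheory.BalabanImbrieJaffe1984to88.BIJ88Smooth43Axial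
import Literature.MathematicalPhysics.QuantumFieldTheory.BalabanImbrieJaffe1984to88.BIJ88NeumannPropagatorFlatDecayCube
import Literature.MathematicalPhysics.QuantumFieldTheory.Balaban1983to89.B3Bound323ZeroTorus

/-!
# [BalabanImbrieJaffe1985] §7.3 p. 326, (7.3.1)–(7.3.2) / [BalabanImbrieJaffe1988] (2.27) p. 262–263 — **THE REGION NEUMANN PROPAGATORS
# `G_k(Ω,u)` UNDER THE PRINTED HYPOTHESIS (7.3.1), SMALL PLAQUETTE VARIABLES, WITH NO GAUGE CONDITION: LOCALITY OF `G_k(Ω,u)` IN `u`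
# (IT DEPENDS ON `u` ONLY THROUGH THE BONDS OF `Ω`), THE CHANGE OF GAUGE OF p. 326, AND THE `k`-UNIFORM KERNEL DECAY
# `|G_k(Ω,u;x,y)| ≤ c₀(L^kε)²e^{−t₀|x−y|_∞/L^k}` (+ THE COVARIANT-DERIVATIVE MEMBER) FOR EVERY `k`-BLOCK UNION INSIDE A NON-WRAPPING BALL**;
# v1.1 (§4): the same for the CUBES `□ = c·L^k + Π_i[0, L^kM_i)` of (2.27) (p31's `cubeT`, the ball around the corner)
# v1.2 (§5): a threshold UNIFORM in the region and the volume — the BLOCKWISE centred gauge, EVERY block union, no enclosing ball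

T. Bałaban, J. Imbrie, A. Jaffe, *Renormalization of the Higgs model: minimizers, propagators and the stability of mean field theory*,
Commun. Math. Phys. **97** (1985) 299–329 [BalabanImbrieJaffe1985], §7.3 p. 326 [PDF 28]; T. Bałaban, J. Imbrie, A. Jaffe, *Effective
action and cluster properties of the abelian Higgs model*, Commun. Math. Phys. **114** (1988) 257–315 [BalabanImbrieJaffe1988], Sect. 2
p. 262–263 [PDF 6–7], (2.27); [7] of [I] = [6] of [II] = [Balaban1983RegularityDecay], Commun. Math. Phys. **89** (1983) 571–597, (1.10)
p. 573; the gauge: T. Bałaban, *Averaging operations for lattice gauge theories*, Commun. Math. Phys. **98** (1985) 17–51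
[Balaban1985Averaging], pp. 24–25 (as landed in p30's `BIJ85CentredAxialGauge`).

statement-level skeleton of published theorems with citation tags; proofs where landed; nothing here is a claim about the Yang–Mills mass gap

PDF held: `paper:balaban1985-cmp97-bij-higgs-minimizers` (journal page = PDF page + 298), p. 326 [PDF 28];
`paper:balaban1988-cmp114-bij-abelian-higgs-effective-action` (journal page = PDF page + 256), p. 262–263 [PDF 6–7].

CITATION HEADER (lean-in-tree rule).  Part of the lit-balaban TYPED SKELETON (HOME `run/shared/lean/pub/lit-balaban/`), PHASE-2 proof seat
p34 gen 16 (unit `lit-balaban-p34-g16`; TAKING lines HOME/STATUS.md 2026-08-22T23:12:49Z and the addendum of 2026-08-23 (file 2 re-scoped);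
free-target protocol G.5-34(d) — the owner's `HOME/lit-balaban-r15/C1-CLOSURE.md` §5 item 3 residual *"the REGION form G_k(Ω, u_k)"*, here
in the PRINTED hypothesis shape (7.3.1)).  Companion of this seat's `BIJ88NeumannPropagatorSmallFieldRegion` (p344577 / v1.1 p345166), whose
decay theorems assume a gauge in which `u` is bondwise close to `1` inside `Ω`; THIS file removes the gauge condition.  WHAT IS REPRODUCED:
a located member of row **C1.Eq7.3.1-7.3.2** (`HOME/lit-balaban-r15/ROWS-C1.md`, owner r15: the p. 326 sentence *"The propagators arising
from Δ_k(u_k), under the restriction (7.3.1) on the gauge field, also satisfy the regularity and decay estimates of [7]"*, for the REGION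
propagators and WITH (7.3.1) AS THE HYPOTHESIS), and the locality cell of row **C2.Eq2.27** (`HOME/lit-balaban-r18/ROWS-C2.md`, owner r18:
p. 262 *"To localize the dependence on u"*).  No head changes.  Kind «model-level theorems only» (no new definition, no `Prop`-valued fact).
p30's `BIJ85CentredAxialGauge.dist1_centredGauge_le`, p33's `BIJ85HolonomyDeviation.norm_holCK_sub_one_le`, gen 15's `gBox_gaugeAct` and
the companion file's theorems are used BY NAME; nothing of them is modified.

THE PRINTED TEXT (verbatim).  [I] p. 326 [PDF 28]: *"In this section we use smallness of the gauge field (7.2.4) to prove (7.2.5) and to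
establish estimates for G_k(Λ₃, u). … These inequalities can be proved by an extension of the proofs of [7]. The propagators arising from
Δ_k(u_k), under the restriction (7.3.1) on the gauge field, also satisfy the regularity and decay estimates of [7]. In order to remain
within the framework of this reference, we remark that by change of gauge u_k can be transformed in a local region Λ into a configuration
of the form exp[ie_kηA], where A is smooth and small."*  [II] p. 262 [PDF 6]: *"In the scalar field sector, we have the η-lattice
propagators G_k(Ω,u) defined on subsets Ω ⊂ T_η with Neumann boundary conditions. To localize the dependence on u, we interpolate in a
smooth fashion between operators with Neumann boundary conditions on small cubes."*

THE OBJECTS (all with bodies; gen 15 `BIJ88NeumannPropagator227Torus`).  `G_k(Ω,u) = gBox a c U k Ω` for a finite union `Ω` of `k`-blocks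
of the fine torus, at the parameters of record `c = ε⁻¹`, `a = α_kL^{kd}`; the plaquette variables `u(∂p) = plaqHol U p` of `Setup`; the
sup-distance `supDist` of the torus; p30's centred axial gauge `centredGauge U x₀ R` of the ball `{|z − x₀|_∞ ≤ R}`.

THE MECHANISM.  (§1) LOCALITY, by induction over the levels of the composite contours (5.1.3): the iterated run transports `u^{(k)}`
(p33's `lineIter`) on the bonds of `T^{(j+k)}` inside a set `S` depend on `u` only through the fine bonds whose end-points have their
`k`-blocks in `S` (`lineIter_congr`; the runs from the corner of `B(y)` stay in `B(y) ∪ B(y + e_μ)`), hence `u(Γ^{(k)}_{x_k,x})` (p11's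
`holCK`) depends on `u` only inside the `k`-block of `x` (`holCK_congr`; the legs of `Γ_{yx}` stay in the block, p31's
`legBond_mem_starB_block`), hence `Q_k(u)|_Ω`, `χ_ΩD_u`, the Neumann operator and **`G_k(Ω,u)` depend on `u` only through `Ω*`**
(`gBox_congr`).  (§2) The modulus of `(D_uG_k(Ω,u)(·,y))(b)` is gauge invariant (`u^h_b = h(b₋)u_b\overline{h(b₊)}`,
`G_k(Ω,u^h) = M_hG_k(Ω,u)M_hᴴ`).  (§3) THE CHANGE OF GAUGE OF p. 326: if `|u(∂p) − 1| ≤ θ` for every plaquette and the ball of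
sup-radius `R` around `x₀` does not wrap (`2R + 4 < |T|`), p30's centred axial gauge `h` gives `|u^h_b − 1| ≤ (d−1)|b₋ − x₀|_∞θ ≤ (d−1)Rθ`
for the bonds starting in the ball; the CUT FIELD `u′ = u^h` on those bonds, `1` elsewhere, is bondwise `T`-small on the WHOLE torus for any
`T ≥ (d−1)Rθ`, so p33's `|u′(Γ^{(k)}_{x_k,x}) − 1| ≤ d(L^k − 1)T` holds everywhere, and the companion file's `decay_kernel_smallField_region` /
`decay_covD_kernel_smallField_region` apply to `u′` on any `k`-block union `Ω` inside the ball under `2(L^k−1)L^k·d·T² + 2(d(L^k−1)T)² ≤ 1/2`;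
finally `G_k(Ω,u′) = G_k(Ω,u^h)` by locality (the bonds of `Ω*` start in the ball) and `|G_k(Ω,u^h;x,y)| = |G_k(Ω,u;x,y)|`.  (§4, v1.1)
For p31's fitting cubes `□ = c·L^k + Π_i[0, L^kM_i)` (`isBlockUnion_cubeT`) every point lies within sup-torus distance `R ≥ L^kM_i` of
the corner (`T_cubePt_le`, `T = supDist`), so §3 applies with the ball around the corner.  (§5, v1.2) The companion file's hypotheses are BLOCK-LOCAL (`T` on the intra-`k`-block bonds, `δ` on
the composite transports), so the change of gauge can be made `k`-BLOCK BY `k`-BLOCK (p27 gen 34): `h(z) =` the centred axial gauge of the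
block of `z`; then `u^h` itself (no cut field on `Ω*`) meets the hypotheses on the whole torus and §3's conclusions hold for EVERY block union.

WHAT IS PROVED (theorems only; 0 `sorry`; standard axioms; no new definition, no `Prop`-valued fact).
* §1 `runProd_congr`, `holC_congr_legBond`, `blockOf_runBond_corner_src`, `blockOf_runBond_corner_tgt`, **`lineIter_congr`**,
  **`holCK_congr`**, `qMatK_congr`, `dN_congr`, `nOp_congr`, **`gBox_congr`** (any level `j`, any `k` with `j + k ≤ m + K`, any `Ω`).
* §2 `cfg_gaugeAct_apply`, **`norm_covD_gBox_gaugeAct`**.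
* §3 **`decay_kernel_smallPlaquette_region`** (`∃ t₀ c₀ > 0` depending on `d, a` only: for every volume with `P.d = d`, every
  `1 ≤ k ≤ m + K`, every `U(1)` field with `‖u(∂p) − 1‖ ≤ θ` (`θ ≥ 0`) for all plaquettes, every `x₀, R` with `2R + 4 < sitesPerDir 0`,
  every union `Ω` of `k`-blocks with `|x − x₀|_∞ ≤ R` on `Ω`, every `T ≥ (d−1)Rθ` with `2(L^k−1)L^k·d·T² + 2(d(L^k−1)T)² ≤ 1/2`, all
  `x, y`: `‖G_k(Ω,u;x,y)‖ ≤ c₀(L^kε)²e^{−t₀|x−y|_∞/L^k}`), **`decay_covD_kernel_smallPlaquette_region`** (same data, every `b ∈ Ω*`, every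
  `y`: `‖ε⁻¹(u_bG_k(Ω,u;b₊,y) − G_k(Ω,u;b₋,y))‖ ≤ c₁(L^kε)e^{−t₀|y−b₊|_∞/L^k}`).
* §4 (v1.1, append-only; imports `+ BIJ88NeumannPropagatorFlatDecayCube`, `+ B3Bound323ZeroTorus`) `supDist_corner_le_of_mem_cubeT`,
  **`decay_kernel_smallPlaquette_cubeT`**, **`decay_covD_kernel_smallPlaquette_cubeT`** (§3 for `Ω = cubeT hPd (L^k) c (L^k·M)` with
  `c_iL^k + L^kM_i ≤ |T^{(0)}|`, `L^kM_i ≤ R`, `2R + 4 < |T^{(0)}|`; `P.d = d + 1`).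
* §5 (v1.2, append-only) **`smallField_blockGauge`** (any level `j`: in the BLOCKWISE centred gauge `h(z) = centredGauge u (corner of the
  `k`-block of z) (L^k − 1) z` the field `u^h` is `T`-small on every bond with both ends in one `k`-block for `T ≥ (d−1)(L^k−1)θ`, and every
  composite transport `u^h(Γ^{(k)}_y)` is within `d(L^k−1)T` of `1`, as soon as `2(L^k−1) + 4 < |T^{(j)}|`; p27 gen 34's inline argument of
  `BIJ88NeumannPropagatorSmallFieldSupDecay` §7, exported), **`decay_kernel_smallPlaquette_region_uniform`**,
  **`decay_covD_kernel_smallPlaquette_region_uniform`** (§3's two members for EVERY union `Ω` of `k`-blocks, NO enclosing ball: hypotheses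
  `2(L^k−1) + 4 < |T^{(0)}|`, `T ≥ (d−1)(L^k−1)θ` and the displayed inequality — a threshold depending on `(d, L^k)` only).

HONEST SCOPE.  (i) KERNEL form, as in the companion file (its HONEST SCOPE (i) applies verbatim: the `k`-uniform `‖f‖_∞` member is not
claimed).  (ii) The region must lie in a NON-WRAPPING ball (`2R + 4 < |T^{(0)}|`; on a wrapping region non-contractible holonomies are
gauge invariant and no such gauge exists — p30's caveat); the smallness asked of `θ` is `θ ≲ (d^{3/2}L^kR)^{−1}` through the displayed
inequality, i.e. it degrades with the radius of the ball (print's regions `Λ` are `O(r(e_k))` cubes of the `L^{−k}`-lattice, for which this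
is (7.3.1)-type smallness `|u(∂p) − 1| ≤ O(L^{−2k}r(e_k)^{−1})`; the plaquette hypothesis is global on the torus, as (7.3.1)).  §5 (v1.2) REMOVES the
enclosing ball (blockwise gauge): the only wrapping caveat left is `2(L^k−1) + 4 < |T^{(0)}|` (more than two `k`-blocks per direction) and
the smallness asked is `θ ≲ (d^{3/2}L^{2k})^{−1}`, uniform in `Ω` and the volume.  (iii) Constants
`t₀, c₀, c₁` are those of the companion file (depending on `(d, a)` only); any `L ≥ 2` (`Params`), `1 ≤ k ≤ m + K`.  (iv) DIVERGENCE OF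
METHOD as in the companion file (region Agmon bound instead of [7]'s random walk); the change of gauge is print's own device.  Nothing here
is summit progress.  Unit `lit-balaban-p34` (literature-prover-lit-balaban-p34-g16-0), HOME `run/shared/lean/pub/lit-balaban/`, 2026-08-23;
v1.1 (§4 appended, §1–§3 byte-identical, two imports added) 2026-08-23; v1.2 (§5 appended, §1–§4 byte-identical; the device is
p27 gen 34's, `BIJ88NeumannPropagatorSmallFieldSupDecay` v1.2 §7) 2026-08-23.
-/

open scoped BigOperators ComplexConjugate
open Finset Matrix

namespace Literature.MathematicalPhysics.QuantumFieldTheory.BalabanImbrieJaffe1984to88.BIJ88NeumannPropagatorSmallPlaquetteRegion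

open Literature.MathematicalPhysics.QuantumFieldTheory.Balaban1983to89
open LatticeFieldCalculus (supDist)
open BIJ88Sect3Statements (U1 toC cfg covD starB mem_starB norm_toC toC_one toC_mul)
open BIJ88RenormTransf311 (inBlock)
open BIJ85BlockAveragesTorus BIJ85BlockAveragesTorusK
open BIJ88NeumannNoZeroModesTorus (IsBlockUnion innerK mem_innerK legBond_mem_starB_block)
open BIJ88NeumannPropagator227Torus (nOp gBox dN qMatK proj cproj nPad nOp_eq qMatK_apply dN_apply)
open BIJ88Vj5610Operator (dMat)
open BIJ88DeltaLoc234Torus (gBox_gaugeAct_apply)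
open BIJ88NeumannPropagatorSmallFieldRegion (decay_kernel_smallField_region decay_covD_kernel_smallField_region)
open BIJ85CentredAxialGauge (centredGauge dist1_centredGauge_le)
open BIJ85HolonomyDeviation (norm_holCK_sub_one_le)
open BIJ88Smooth43Axial (dist1_eq_norm_toC_sub_one)
open GaugeField (gaugeAct plaqHol)
open BIJ88NeumannPropagatorFlatDecayCube (cubePt cubeT mem_cubeT T_cubePt_le isBlockUnion_cubeT)
open B4Reflection242 (boxDom mem_boxDom supNorm_le_of_forall)
open B4ContourShift (supNorm)

noncomputable section

variable {P : Params} {j : ℕ}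

/-! ## §1 Locality: the transports, the `k`-level average and `G_k(Ω,u)` depend on `u` only through the bonds of `Ω` -/

/-- kernel: the ordered product along a straight run depends only on the bonds of the run. [cite: BalabanImbrieJaffe1985, (2.5) p.302] -/
theorem runProd_congr {U U' : GaugeField P j U1} {x : Balaban1983to89.Site P j} {μ : Fin P.d} :
    ∀ {n : ℕ}, (∀ t, t < n → U (runBond x μ t) = U' (runBond x μ t)) → runProd U x μ n = runProd U' x μ n
  | 0, _ => rfl
  | n + 1, h => by
    rw [runProd, runProd, runProd_congr fun t ht => h t (Nat.lt_succ_of_lt ht), h n (Nat.lt_succ_self n)]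

/-- kernel: `u(Γ_{yx})` depends only on the bonds of the contour `Γ_{yx}` (the legs `legBond x μ t`, `t < inBlock x μ`).
[cite: BalabanImbrieJaffe1985, (2.5) p.302] -/
theorem holC_congr_legBond {U U' : GaugeField P j U1} {x : Balaban1983to89.Site P j}
    (h : ∀ (μ : Fin P.d) (t : ℕ), t < inBlock x μ → U (legBond x μ t) = U' (legBond x μ t)) : holC U x = holC U' x :=
  prod_congr rfl fun μ _ => prod_congr rfl fun t ht => by rw [h μ t (mem_range.1 ht)]

/-- kernel: the bonds of the run `Γ_{yy′}` from the corner of `B(y)` start in `B(y)`. [cite: BalabanImbrieJaffe1985, (2.10) p.303] -/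
theorem blockOf_runBond_corner_src (hj : j + 1 ≤ P.m + P.K) (y : Balaban1983to89.Site P (j+1)) (μ : Fin P.d) {t : ℕ} (ht : t < P.L) :
    blockOf (runBond (corner y) μ t).src = y := by
  show blockOf (runSite (corner y) μ t) = y
  rw [blockOf_runSite_lo hj (corner y) μ (by rw [inBlock_corner hj]; omega), blockOf_corner hj]

/-- kernel: the bonds of the run `Γ_{yy′}` from the corner of `B(y)` end in `B(y)` or (the last one) in `B(y′)`, `y′ = y + e_μ`.
[cite: BalabanImbrieJaffe1985, (2.10) p.303] -/
theorem blockOf_runBond_corner_tgt (hj : j + 1 ≤ P.m + P.K) (y : Balaban1983to89.Site P (j+1)) (μ : Fin P.d) {t : ℕ} (ht : t < P.L) :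
    blockOf (runBond (corner y) μ t).tgt = y ∨ blockOf (runBond (corner y) μ t).tgt = y.shift μ := by
  rw [runBond_tgt]
  rcases Nat.lt_or_ge (t + 1) P.L with h | h
  · left
    rw [blockOf_runSite_lo hj (corner y) μ (by rw [inBlock_corner hj]; omega), blockOf_corner hj]
  · right
    have : t + 1 = P.L := le_antisymm ht h
    rw [this, ← corner_shift hj, blockOf_corner hj]

/-- **LOCALITY OF THE ITERATED RUN TRANSPORTS**: `u^{(k)}(Γ_{yy′})` depends on `u` only through the bonds whose end-points have their
`k`-blocks in `{y, y′}` — precisely, for a set `S` of sites of `T^{(j+k)}`, if `u = u′` on every bond with `(b₋)_k, (b₊)_k ∈ S` then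
`u^{(k)} = u′^{(k)}` on the bonds of `T^{(j+k)}` inside `S`. [cite: BalabanImbrieJaffe1985, (5.1.2)–(5.1.3) p.313] -/
theorem lineIter_congr : ∀ (k : ℕ), j + k ≤ P.m + P.K → ∀ {U U' : GaugeField P j U1} (S : Finset (Balaban1983to89.Site P (j+k))),
    (∀ b : PBond P j, blkIter k b.src ∈ S → blkIter k b.tgt ∈ S → U b = U' b) →
      ∀ c : PBond P (j+k), c.src ∈ S → c.tgt ∈ S → lineIter U k c = lineIter U' k c
  | 0, _, U, U', S, h, c, hs, ht => by
    rw [lineIter_zero, lineIter_zero]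
    exact h c hs ht
  | k + 1, hk, U, U', S, h, c, hs, ht => by
    have hk' : j + k ≤ P.m + P.K := by omega
    have hj' : j + k + 1 ≤ P.m + P.K := by omega
    rw [lineIter_succ]
    show runProd (lineIter U k) (corner c.src) c.dir P.L = runProd (lineIter U' k) (corner c.src) c.dir P.L
    refine runProd_congr fun t htL => ?_
    refine lineIter_congr k hk' (univ.filter fun z : Balaban1983to89.Site P (j+k) => blockOf z ∈ S) ?_ _ ?_ ?_
    · intro b hb1 hb2
      rw [mem_filter] at hb1 hb2
      exact h b hb1.2 hb2.2
    · rw [mem_filter, blockOf_runBond_corner_src hj' c.src c.dir htL]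
      exact ⟨mem_univ _, hs⟩
    · rw [mem_filter]
      refine ⟨mem_univ _, ?_⟩
      rcases blockOf_runBond_corner_tgt hj' c.src c.dir htL with h1 | h1
      · rw [h1]; exact hs
      · rw [h1]; exact ht

/-- **LOCALITY OF THE COMPOSITE TRANSPORT `u(Γ^{(k)}_{x_k,x})`** (p11's `holCK`): it depends on `u` only through the bonds with both
end-points in the `k`-block `B^k(x_k)` of `x` (the contour (5.1.3) stays in that block). [cite: BalabanImbrieJaffe1985, (5.1.2)–(5.1.3) p.313] -/
theorem holCK_congr : ∀ (k : ℕ), j + k ≤ P.m + P.K → ∀ {U U' : GaugeField P j U1} (x : Balaban1983to89.Site P j),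
    (∀ b : PBond P j, blkIter k b.src = blkIter k x → blkIter k b.tgt = blkIter k x → U b = U' b) →
      holCK U k x = holCK U' k x
  | 0, _, U, U', x, _ => by rw [holCK_zero, holCK_zero]
  | k + 1, hk, U, U', x, h => by
    have hk' : j + k ≤ P.m + P.K := by omega
    have hj' : j + k + 1 ≤ P.m + P.K := by omega
    rw [holCK_succ, holCK_succ]
    congr 1
    · refine holC_congr_legBond fun μ t ht => ?_
      have hmem := legBond_mem_starB_block hj' (blkIter k x) μ ht
      rw [mem_starB] at hmem
      refine lineIter_congr k hk' (block (blockOf (blkIter k x))) (fun b hb1 hb2 => h b ?_ ?_) _ hmem.1 hmem.2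
      · rw [blkIter_succ, blkIter_succ]; exact mem_block_iff.1 hb1
      · rw [blkIter_succ, blkIter_succ]; exact mem_block_iff.1 hb2
    · exact holCK_congr k hk' x fun b hb1 hb2 => h b (by rw [blkIter_succ, blkIter_succ, hb1]) (by rw [blkIter_succ, blkIter_succ, hb2])

/-- **LOCALITY OF `Q_k(u)|_Ω`**: the restricted `k`-level average depends on `u` only through the bonds of `Ω*`.
[cite: BalabanImbrieJaffe1988, (2.27) p.263] -/
theorem qMatK_congr {k : ℕ} (hk : j + k ≤ P.m + P.K) {U U' : GaugeField P j U1} {Ω : Finset (Balaban1983to89.Site P j)}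
    (h : ∀ b ∈ starB Ω, U b = U' b) : qMatK U k Ω = qMatK U' k Ω := by
  ext y x
  rw [qMatK_apply, qMatK_apply]
  by_cases hc : blockK k y ⊆ Ω ∧ x ∈ blockK k y
  · rw [if_pos hc, if_pos hc, holCK_congr k hk x fun b hb1 hb2 => h b ?_]
    have hy : blkIter k x = y := mem_blockK.1 hc.2
    rw [mem_starB]
    exact ⟨hc.1 (mem_blockK.2 (hb1.trans hy)), hc.1 (mem_blockK.2 (hb2.trans hy))⟩
  · rw [if_neg hc, if_neg hc]

/-- **LOCALITY OF THE NEUMANN-CUT COVARIANT DERIVATIVE `χ_ΩD_u`**: it depends on `u` only through the bonds of `Ω*`.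
[cite: BalabanImbrieJaffe1988, (2.27) p.263] -/
theorem dN_congr {c : ℝ} {U U' : GaugeField P j U1} {Ω : Finset (Balaban1983to89.Site P j)} (h : ∀ b ∈ starB Ω, U b = U' b) :
    dN c U Ω = dN c U' Ω := by
  ext b x
  rw [dN_apply, dN_apply]
  split_ifs with hb
  · simp only [dMat, Matrix.of_apply, cfg, h b hb]
  · rfl

/-- **LOCALITY OF THE NEUMANN OPERATOR**: `−Δ^N_{u,Ω} + aQ_k(u)|_Ωᴴ Q_k(u)|_Ω` depends on `u` only through the bonds of `Ω*`.
[cite: BalabanImbrieJaffe1988, (2.27) p.263] -/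
theorem nOp_congr {k : ℕ} (hk : j + k ≤ P.m + P.K) (a c : ℝ) {U U' : GaugeField P j U1} {Ω : Finset (Balaban1983to89.Site P j)}
    (h : ∀ b ∈ starB Ω, U b = U' b) : nOp a c U k Ω = nOp a c U' k Ω := by
  rw [nOp_eq, nOp_eq, dN_congr h, qMatK_congr hk h]

/-- **LOCALITY OF `G_k(Ω,u)`** — the point of (2.27) (p. 262: *"To localize the dependence on u, we interpolate … between operators with
Neumann boundary conditions on small cubes"*): the region propagator depends on `u` only through the bonds of `Ω*`.
[cite: BalabanImbrieJaffe1988, (2.27) p.263] -/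
theorem gBox_congr {k : ℕ} (hk : j + k ≤ P.m + P.K) (a c : ℝ) {U U' : GaugeField P j U1} {Ω : Finset (Balaban1983to89.Site P j)}
    (h : ∀ b ∈ starB Ω, U b = U' b) : gBox a c U k Ω = gBox a c U' k Ω := by
  show (nPad a c U k Ω)⁻¹ * proj Ω = (nPad a c U' k Ω)⁻¹ * proj Ω
  rw [show nPad a c U k Ω = nPad a c U' k Ω from by unfold nPad; rw [nOp_congr hk a c h]]

/-! ## §2 Gauge covariance of the covariant derivative of the kernel -/

/-- kernel: the bond variable of the gauge transform read in `ℂ`, `u^h_b = h(b₋)u_b\overline{h(b₊)}`. [cite: BalabanImbrieJaffe1985, (2.7) p.303] -/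
theorem cfg_gaugeAct_apply (h : GaugeTransf P j U1) (U : GaugeField P j U1) (b : PBond P j) :
    cfg (gaugeAct h U) b = toC (h b.src) * cfg U b * conj (toC (h b.tgt)) := by
  show toC (gaugeAct h U b) = _
  rw [toC_gaugeAct, BIJ88NeumannPropagator227Torus.conj_toC]
  rfl

/-- **THE MODULUS OF THE COVARIANT DERIVATIVE OF THE KERNEL IS GAUGE INVARIANT**: with `G_k(Ω,u^h;x,y) = h(x)G_k(Ω,u;x,y)\overline{h(y)}`
(gen 15 `gBox_gaugeAct`) and `u^h_b = h(b₋)u_b\overline{h(b₊)}`,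
`(D_{u^h}G_k(Ω,u^h)(·,y))(b) = h(b₋)·(D_uG_k(Ω,u)(·,y))(b)·\overline{h(y)}`. [cite: BalabanImbrieJaffe1985, (7.3.2) p.326] -/
theorem norm_covD_gBox_gaugeAct {k : ℕ} (hk : j + k ≤ P.m + P.K) {c : ℝ} (hc : c ≠ 0) {a : ℝ} (ha : 0 < a) (h : GaugeTransf P j U1)
    (U : GaugeField P j U1) {Ω : Finset (Balaban1983to89.Site P j)} (hΩ : IsBlockUnion k Ω) (b : PBond P j)
    (y : Balaban1983to89.Site P j) :
    ‖covD c (cfg (gaugeAct h U)) (fun x => gBox a c (gaugeAct h U) k Ω x y) b‖ =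
      ‖covD c (cfg U) (fun x => gBox a c U k Ω x y) b‖ := by
  have e : covD c (cfg (gaugeAct h U)) (fun x => gBox a c (gaugeAct h U) k Ω x y) b =
      toC (h b.src) * covD c (cfg U) (fun x => gBox a c U k Ω x y) b * conj (toC (h y)) := by
    simp only [covD]
    rw [gBox_gaugeAct_apply hk hc ha h U hΩ b.tgt y, gBox_gaugeAct_apply hk hc ha h U hΩ b.src y, cfg_gaugeAct_apply]
    have h1 : conj (toC (h b.tgt)) * toC (h b.tgt) = 1 := BIJ88NeumannPropagator227Torus.conj_mul_toC _
    calc (c : ℂ) * (toC (h b.src) * cfg U b * conj (toC (h b.tgt)) * (toC (h b.tgt) * gBox a c U k Ω b.tgt y * conj (toC (h y))) -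
          toC (h b.src) * gBox a c U k Ω b.src y * conj (toC (h y)))
        = (c : ℂ) * (toC (h b.src) * cfg U b * (conj (toC (h b.tgt)) * toC (h b.tgt)) * gBox a c U k Ω b.tgt y * conj (toC (h y)) -
          toC (h b.src) * gBox a c U k Ω b.src y * conj (toC (h y))) := by ring
      _ = _ := by rw [h1]; ring
  rw [e, norm_mul, norm_mul, norm_toC, one_mul, RCLike.norm_conj, norm_toC, mul_one]

/-! ## §3 The kernel decay of `G_k(Ω,u)` under the plaquette smallness (7.3.1), for regions inside a non-wrapping ball -/

/-- **THE KERNEL DECAY OF THE REGION NEUMANN PROPAGATORS UNDER THE PRINTED HYPOTHESIS (7.3.1) — SMALL PLAQUETTE VARIABLES — WITH NO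
GAUGE CONDITION**: there are `t₀, c₀ > 0` depending on `(d, a)` only such that for every volume with `P.d = d`, every `1 ≤ k ≤ m + K`,
every `U(1)` field with `|u(∂p) − 1| ≤ θ` for all plaquettes of the fine torus, every ball `{|z − x₀|_∞ ≤ R}` that does not wrap
(`2R + 4 < |T|`), every union `Ω` of `k`-blocks inside that ball and every `T ≥ (d−1)Rθ` with
`2(L^k−1)L^k·d·T² + 2(d(L^k−1)T)² ≤ 1/2`: `‖G_k(Ω,u;x,y)‖ ≤ c₀(L^kε)²e^{−t₀|x−y|_∞/L^k}` for all `x, y`.  PROOF = print's sentence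
*"by change of gauge u_k can be transformed in a local region Λ into a configuration … smooth and small"*: p30's centred axial gauge `h`
of the ball (`dist1_centredGauge_le`: `|u^h_b − 1| ≤ (d−1)|b₋ − x₀|_∞θ` inside the ball), the field `u′ = u^h` on the bonds starting in
the ball and `1` elsewhere (bondwise `T`-small everywhere, so `|u′(Γ^{(k)}_{x_k,x}) − 1| ≤ d(L^k−1)T`, p33's `norm_holCK_sub_one_le`),
the companion file's `decay_kernel_smallField_region` for `u′`, the locality `G_k(Ω,u′) = G_k(Ω,u^h)` (§1) and the gauge invariance of
the modulus (gen 15 `gBox_gaugeAct`). [cite: BalabanImbrieJaffe1985, (7.3.1)–(7.3.2) p.326] -/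
theorem decay_kernel_smallPlaquette_region (d : ℕ) {a : ℝ} (ha : 0 < a) :
    ∃ t₀ c₀ : ℝ, 0 < t₀ ∧ 0 < c₀ ∧ ∀ (P : Params), P.d = d →
      ∀ k : ℕ, 1 ≤ k → k ≤ P.m + P.K → ∀ (U : GaugeField P 0 U1) (θ : ℝ), 0 ≤ θ →
        (∀ p : Balaban1983to89.Plaq P 0, ‖toC (plaqHol U p) - 1‖ ≤ θ) →
        ∀ (x₀ : Balaban1983to89.Site P 0) (R : ℕ), 2 * R + 4 < P.sitesPerDir 0 →
        ∀ (Ω : Finset (Balaban1983to89.Site P 0)), IsBlockUnion k Ω → (∀ x ∈ Ω, supDist x₀ x ≤ R) →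
        ∀ (T : ℝ), ((P.d - 1 : ℕ) : ℝ) * R * θ ≤ T →
          2 * (((P.L : ℝ) ^ k - 1) * (P.L : ℝ) ^ k) * P.d * T ^ 2 + 2 * (P.d * ((P.L : ℝ) ^ k - 1) * T) ^ 2 ≤ 1 / 2 →
          ∀ x y : Balaban1983to89.Site P 0,
            ‖gBox (B1RG242Torus.α P a k * (P.L : ℝ) ^ (k * P.d)) P.eps⁻¹ U k Ω x y‖ ≤
              c₀ * P.spacing k ^ 2 * Real.exp (-(t₀ * (supDist x y : ℝ) / (P.L : ℝ) ^ k)) := by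
  obtain ⟨t₀, c₀, ht₀, hc₀, H⟩ := decay_kernel_smallField_region d ha
  refine ⟨t₀, c₀, ht₀, hc₀, ?_⟩
  intro P hPd k hk1 hk U θ hθ hplaq x₀ R hR Ω hΩ hΩR T hT hsmall x y
  have hk0 : 0 + k ≤ P.m + P.K := by omega
  have hL1 : (1 : ℝ) < P.L := B1RG242Torus.one_lt_cast_L P
  have hα : 0 < B1RG242Torus.α P a k := mul_pos (B1.aSeq_pos ha hL1 hk1) (inv_pos.2 (pow_pos (P.spacing_pos k) 2))
  have ha' : 0 < B1RG242Torus.α P a k * (P.L : ℝ) ^ (k * P.d) := mul_pos hα (pow_pos P.cast_L_pos _)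
  have hc : P.eps⁻¹ ≠ 0 := inv_ne_zero P.eps_pos.ne'
  have hT0 : 0 ≤ T := le_trans (by positivity) hT
  -- the plaquette bound in the interface distance
  have hplaq' : ∀ p : Balaban1983to89.Plaq P 0, dist1 (plaqHol U p) ≤ θ := fun p => by
    rw [dist1_eq_norm_toC_sub_one]; exact hplaq p
  -- the centred gauge of the ball and the field cut to the ball
  set h : GaugeTransf P 0 U1 := centredGauge U x₀ R with hh
  set U' : GaugeField P 0 U1 := fun b => if supDist x₀ b.src ≤ R then gaugeAct h U b else 1 with hU'
  have hbond : ∀ b : PBond P 0, ‖toC (U' b) - 1‖ ≤ T := fun b => by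
    by_cases hb : supDist x₀ b.src ≤ R
    · have h1 : U' b = gaugeAct h U ⟨b.src, b.dir⟩ := by simp only [hU', hb, if_true]
      have h2 := dist1_centredGauge_le U hθ hplaq' x₀ hR b.src hb b.dir
      rw [dist1_eq_norm_toC_sub_one, ← hh] at h2
      rw [h1]
      refine h2.trans (le_trans ?_ hT)
      have : (supDist x₀ b.src : ℝ) ≤ R := by exact_mod_cast hb
      exact mul_le_mul_of_nonneg_right (mul_le_mul_of_nonneg_left this (Nat.cast_nonneg _)) hθ
    · have h1 : U' b = 1 := by simp only [hU', hb, if_false]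
      rw [h1, toC_one, sub_self, norm_zero]; exact hT0
  have htree : ∀ z : Balaban1983to89.Site P 0, ‖holCK U' k z - 1‖ ≤ P.d * ((P.L : ℝ) ^ k - 1) * T := fun z =>
    norm_holCK_sub_one_le hT0 hbond k z
  -- the companion file's theorem for the cut field
  have hdec := H P hPd k hk1 hk Ω hΩ U' T (P.d * ((P.L : ℝ) ^ k - 1) * T) (fun b _ _ => hbond b) (fun z _ => htree z) hsmall x y
  -- locality and gauge invariance of the modulus
  have hloc : gBox (B1RG242Torus.α P a k * (P.L : ℝ) ^ (k * P.d)) P.eps⁻¹ U' k Ω =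
      gBox (B1RG242Torus.α P a k * (P.L : ℝ) ^ (k * P.d)) P.eps⁻¹ (gaugeAct h U) k Ω :=
    gBox_congr hk0 _ _ fun b hb => by
      have hbs : supDist x₀ b.src ≤ R := hΩR b.src ((mem_starB Ω b).1 hb).1
      simp only [hU', hbs, if_true]
  rw [hloc, gBox_gaugeAct_apply hk0 hc ha' h U hΩ x y, norm_mul, norm_mul, norm_toC, one_mul, RCLike.norm_conj, norm_toC,
    mul_one] at hdec
  exact hdec

/-- **THE COVARIANT-DERIVATIVE MEMBER UNDER THE PLAQUETTE SMALLNESS (7.3.1)**, same data: for every bond `b ∈ Ω*` and every `y`,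
`‖ε⁻¹(u_bG_k(Ω,u;b₊,y) − G_k(Ω,u;b₋,y))‖ ≤ c₁(L^kε)e^{−t₀|y−b₊|_∞/L^k}`, `t₀, c₁ > 0` depending on `(d, a)` only (the companion file's
`decay_covD_kernel_smallField_region` for the cut field in the centred gauge, locality, and the gauge invariance of the modulus of the
covariant derivative of the kernel, §2). [cite: BalabanImbrieJaffe1985, (7.3.1)–(7.3.2) p.326] -/
theorem decay_covD_kernel_smallPlaquette_region (d : ℕ) {a : ℝ} (ha : 0 < a) :
    ∃ t₀ c₁ : ℝ, 0 < t₀ ∧ 0 < c₁ ∧ ∀ (P : Params), P.d = d →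
      ∀ k : ℕ, 1 ≤ k → k ≤ P.m + P.K → ∀ (U : GaugeField P 0 U1) (θ : ℝ), 0 ≤ θ →
        (∀ p : Balaban1983to89.Plaq P 0, ‖toC (plaqHol U p) - 1‖ ≤ θ) →
        ∀ (x₀ : Balaban1983to89.Site P 0) (R : ℕ), 2 * R + 4 < P.sitesPerDir 0 →
        ∀ (Ω : Finset (Balaban1983to89.Site P 0)), IsBlockUnion k Ω → (∀ x ∈ Ω, supDist x₀ x ≤ R) →
        ∀ (T : ℝ), ((P.d - 1 : ℕ) : ℝ) * R * θ ≤ T →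
          2 * (((P.L : ℝ) ^ k - 1) * (P.L : ℝ) ^ k) * P.d * T ^ 2 + 2 * (P.d * ((P.L : ℝ) ^ k - 1) * T) ^ 2 ≤ 1 / 2 →
          ∀ b ∈ starB Ω, ∀ y : Balaban1983to89.Site P 0,
            ‖covD P.eps⁻¹ (cfg U) (fun x => gBox (B1RG242Torus.α P a k * (P.L : ℝ) ^ (k * P.d)) P.eps⁻¹ U k Ω x y) b‖ ≤
              c₁ * P.spacing k * Real.exp (-(t₀ * (supDist y b.tgt : ℝ) / (P.L : ℝ) ^ k)) := by
  obtain ⟨t₀, c₁, ht₀, hc₁, H⟩ := decay_covD_kernel_smallField_region d ha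
  refine ⟨t₀, c₁, ht₀, hc₁, ?_⟩
  intro P hPd k hk1 hk U θ hθ hplaq x₀ R hR Ω hΩ hΩR T hT hsmall b hb y
  have hk0 : 0 + k ≤ P.m + P.K := by omega
  have hL1 : (1 : ℝ) < P.L := B1RG242Torus.one_lt_cast_L P
  have hα : 0 < B1RG242Torus.α P a k := mul_pos (B1.aSeq_pos ha hL1 hk1) (inv_pos.2 (pow_pos (P.spacing_pos k) 2))
  have ha' : 0 < B1RG242Torus.α P a k * (P.L : ℝ) ^ (k * P.d) := mul_pos hα (pow_pos P.cast_L_pos _)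
  have hc : P.eps⁻¹ ≠ 0 := inv_ne_zero P.eps_pos.ne'
  have hT0 : 0 ≤ T := le_trans (by positivity) hT
  have hplaq' : ∀ p : Balaban1983to89.Plaq P 0, dist1 (plaqHol U p) ≤ θ := fun p => by
    rw [dist1_eq_norm_toC_sub_one]; exact hplaq p
  set h : GaugeTransf P 0 U1 := centredGauge U x₀ R with hh
  set U' : GaugeField P 0 U1 := fun b => if supDist x₀ b.src ≤ R then gaugeAct h U b else 1 with hU'
  have hbond : ∀ b : PBond P 0, ‖toC (U' b) - 1‖ ≤ T := fun b => by
    by_cases hb : supDist x₀ b.src ≤ R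
    · have h1 : U' b = gaugeAct h U ⟨b.src, b.dir⟩ := by simp only [hU', hb, if_true]
      have h2 := dist1_centredGauge_le U hθ hplaq' x₀ hR b.src hb b.dir
      rw [dist1_eq_norm_toC_sub_one, ← hh] at h2
      rw [h1]
      refine h2.trans (le_trans ?_ hT)
      have : (supDist x₀ b.src : ℝ) ≤ R := by exact_mod_cast hb
      exact mul_le_mul_of_nonneg_right (mul_le_mul_of_nonneg_left this (Nat.cast_nonneg _)) hθ
    · have h1 : U' b = 1 := by simp only [hU', hb, if_false]
      rw [h1, toC_one, sub_self, norm_zero]; exact hT0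
  have htree : ∀ z : Balaban1983to89.Site P 0, ‖holCK U' k z - 1‖ ≤ P.d * ((P.L : ℝ) ^ k - 1) * T := fun z =>
    norm_holCK_sub_one_le hT0 hbond k z
  have hdec := H P hPd k hk1 hk Ω hΩ U' T (P.d * ((P.L : ℝ) ^ k - 1) * T) (fun b _ _ => hbond b) (fun z _ => htree z) hsmall b hb y
  have hagree : ∀ b' ∈ starB Ω, U' b' = gaugeAct h U b' := fun b' hb' => by
    have hbs : supDist x₀ b'.src ≤ R := hΩR b'.src ((mem_starB Ω b').1 hb').1
    simp only [hU', hbs, if_true]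
  have hloc : gBox (B1RG242Torus.α P a k * (P.L : ℝ) ^ (k * P.d)) P.eps⁻¹ U' k Ω =
      gBox (B1RG242Torus.α P a k * (P.L : ℝ) ^ (k * P.d)) P.eps⁻¹ (gaugeAct h U) k Ω := gBox_congr hk0 _ _ hagree
  have hcov : covD P.eps⁻¹ (cfg U') (fun x => gBox (B1RG242Torus.α P a k * (P.L : ℝ) ^ (k * P.d)) P.eps⁻¹ U' k Ω x y) b =
      covD P.eps⁻¹ (cfg (gaugeAct h U))
        (fun x => gBox (B1RG242Torus.α P a k * (P.L : ℝ) ^ (k * P.d)) P.eps⁻¹ (gaugeAct h U) k Ω x y) b := by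
    simp only [covD, cfg, hloc, hagree b hb]
  rw [hcov, norm_covD_gBox_gaugeAct hk0 hc ha' h U hΩ b y] at hdec
  exact hdec


/-! ## §4 (v1.1) The cubes `□ = c·L^k + Π_i[0, L^kM_i)` of (2.27) (p31's `cubeT`): the ball around the corner -/

section Cube

variable {d : ℕ}

/-- kernel: every point of a cube that fits (`c_in + N_i ≤ |T^{(0)}|`) lies within sup-torus distance `R` of its corner `c·n` as soon as
`N_i ≤ R` for all `i` (p31's chart bound `T_cubePt_le` and the metric dictionary `T = supDist`).
[cite: BalabanImbrieJaffe1988, (2.27) p.263] -/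
theorem supDist_corner_le_of_mem_cubeT (hPd : P.d = d + 1) {n : ℕ} {c N : Fin (d + 1) → ℕ}
    (hfit : ∀ i, c i * n + N i ≤ P.sitesPerDir 0) {R : ℕ} (hR : ∀ i, N i ≤ R) {x : Balaban1983to89.Site P 0}
    (hx : x ∈ cubeT hPd n c N) : supDist (cubePt hPd n c 0) x ≤ R := by
  obtain ⟨z, hz, rfl⟩ := (mem_cubeT hPd).1 hx
  have hz' := mem_boxDom.1 hz
  have h0 : (0 : Fin (d + 1) → ℤ) ∈ boxDom N :=
    mem_boxDom.2 fun i => by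
      have := hz' i
      refine ⟨le_rfl, ?_⟩
      show (0 : ℤ) < N i
      omega
  have h1 := T_cubePt_le hPd hfit h0 hz
  rw [B3Bound323ZeroTorus.T_eq_supDist] at h1
  have h2 : supNorm (0 - z) ≤ R := supNorm_le_of_forall fun i => by
    have hzi := hz' i
    have hRi := hR i
    rw [Pi.sub_apply, Pi.zero_apply, zero_sub, abs_neg, abs_of_nonneg hzi.1]
    have : z i ≤ (R : ℤ) := by omega
    exact_mod_cast this
  exact_mod_cast h1.trans h2

/-- **THE KERNEL DECAY OF THE CUBE PROPAGATORS `G_k(□,u)` OF (2.27) UNDER THE PLAQUETTE SMALLNESS (7.3.1)** — `decay_kernel_smallPlaquette_region`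
for p31's fitting cubes `□ = c·L^k + Π_i[0, L^kM_i)` (`isBlockUnion_cubeT`) inside the ball of sup-radius `R ≥ L^kM_i` around the corner,
`2R + 4 < |T^{(0)}|`: `‖G_k(□,u;x,y)‖ ≤ c₀(L^kε)²e^{−t₀|x−y|_∞/L^k}` for all `x, y`, with NO gauge condition.
[cite: BalabanImbrieJaffe1988, (2.27) p.263] -/
theorem decay_kernel_smallPlaquette_cubeT (d : ℕ) {a : ℝ} (ha : 0 < a) :
    ∃ t₀ c₀ : ℝ, 0 < t₀ ∧ 0 < c₀ ∧ ∀ (P : Params) (hPd : P.d = d + 1),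
      ∀ k : ℕ, 1 ≤ k → k ≤ P.m + P.K → ∀ (U : GaugeField P 0 U1) (θ : ℝ), 0 ≤ θ →
        (∀ p : Balaban1983to89.Plaq P 0, ‖toC (plaqHol U p) - 1‖ ≤ θ) →
        ∀ (c M : Fin (d + 1) → ℕ) (R : ℕ), (∀ i, c i * P.L ^ k + P.L ^ k * M i ≤ P.sitesPerDir 0) →
          (∀ i, P.L ^ k * M i ≤ R) → 2 * R + 4 < P.sitesPerDir 0 →
        ∀ (T : ℝ), ((P.d - 1 : ℕ) : ℝ) * R * θ ≤ T →
          2 * (((P.L : ℝ) ^ k - 1) * (P.L : ℝ) ^ k) * P.d * T ^ 2 + 2 * (P.d * ((P.L : ℝ) ^ k - 1) * T) ^ 2 ≤ 1 / 2 →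
          ∀ x y : Balaban1983to89.Site P 0,
            ‖gBox (B1RG242Torus.α P a k * (P.L : ℝ) ^ (k * P.d)) P.eps⁻¹ U k (cubeT hPd (P.L ^ k) c fun i => P.L ^ k * M i) x y‖ ≤
              c₀ * P.spacing k ^ 2 * Real.exp (-(t₀ * (supDist x y : ℝ) / (P.L : ℝ) ^ k)) := by
  obtain ⟨t₀, c₀, ht₀, hc₀, H⟩ := decay_kernel_smallPlaquette_region (d + 1) ha
  refine ⟨t₀, c₀, ht₀, hc₀, ?_⟩
  intro P hPd k hk1 hk U θ hθ hplaq c M R hfit hRM hR T hT hsmall x y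
  exact H P hPd k hk1 hk U θ hθ hplaq (cubePt hPd (P.L ^ k) c 0) R hR _ (isBlockUnion_cubeT hPd (by omega) rfl hfit)
    (fun z hz => supDist_corner_le_of_mem_cubeT hPd hfit hRM hz) T hT hsmall x y

/-- **THE COVARIANT-DERIVATIVE MEMBER FOR THE CUBE PROPAGATORS UNDER THE PLAQUETTE SMALLNESS (7.3.1)**, same data, every bond `b ∈ □*`,
every `y`: `‖ε⁻¹(u_bG_k(□,u;b₊,y) − G_k(□,u;b₋,y))‖ ≤ c₁(L^kε)e^{−t₀|y−b₊|_∞/L^k}`. [cite: BalabanImbrieJaffe1988, (2.27) p.263] -/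
theorem decay_covD_kernel_smallPlaquette_cubeT (d : ℕ) {a : ℝ} (ha : 0 < a) :
    ∃ t₀ c₁ : ℝ, 0 < t₀ ∧ 0 < c₁ ∧ ∀ (P : Params) (hPd : P.d = d + 1),
      ∀ k : ℕ, 1 ≤ k → k ≤ P.m + P.K → ∀ (U : GaugeField P 0 U1) (θ : ℝ), 0 ≤ θ →
        (∀ p : Balaban1983to89.Plaq P 0, ‖toC (plaqHol U p) - 1‖ ≤ θ) →
        ∀ (c M : Fin (d + 1) → ℕ) (R : ℕ), (∀ i, c i * P.L ^ k + P.L ^ k * M i ≤ P.sitesPerDir 0) →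
          (∀ i, P.L ^ k * M i ≤ R) → 2 * R + 4 < P.sitesPerDir 0 →
        ∀ (T : ℝ), ((P.d - 1 : ℕ) : ℝ) * R * θ ≤ T →
          2 * (((P.L : ℝ) ^ k - 1) * (P.L : ℝ) ^ k) * P.d * T ^ 2 + 2 * (P.d * ((P.L : ℝ) ^ k - 1) * T) ^ 2 ≤ 1 / 2 →
          ∀ b ∈ starB (cubeT hPd (P.L ^ k) c fun i => P.L ^ k * M i), ∀ y : Balaban1983to89.Site P 0,
            ‖covD P.eps⁻¹ (cfg U) (fun x => gBox (B1RG242Torus.α P a k * (P.L : ℝ) ^ (k * P.d)) P.eps⁻¹ U k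
                (cubeT hPd (P.L ^ k) c fun i => P.L ^ k * M i) x y) b‖ ≤
              c₁ * P.spacing k * Real.exp (-(t₀ * (supDist y b.tgt : ℝ) / (P.L : ℝ) ^ k)) := by
  obtain ⟨t₀, c₁, ht₀, hc₁, H⟩ := decay_covD_kernel_smallPlaquette_region (d + 1) ha
  refine ⟨t₀, c₁, ht₀, hc₁, ?_⟩
  intro P hPd k hk1 hk U θ hθ hplaq c M R hfit hRM hR T hT hsmall b hb y
  exact H P hPd k hk1 hk U θ hθ hplaq (cubePt hPd (P.L ^ k) c 0) R hR _ (isBlockUnion_cubeT hPd (by omega) rfl hfit)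
    (fun z hz => supDist_corner_le_of_mem_cubeT hPd hfit hRM hz) T hT hsmall b hb y

end Cube

/-! ## §5 (v1.2) A threshold UNIFORM in the region and the volume: the BLOCKWISE centred gauge (p27 gen 34's device for the cube value
member, `BIJ88NeumannPropagatorSmallFieldSupDecay.decay110_smallPlaquette_cube_uniform`) — the companion file's hypotheses are block-local,
so the change of gauge of p. 326 is made `k`-block by `k`-block; EVERY block union `Ω`, no enclosing ball -/

section Uniform

open BIJ85ScalarPropagatorDecay (supDist_le_of_blkIter_eq)

/-- kernel: **the blockwise centred gauge** — `h(z) =` p30's centred axial gauge of the `k`-block of `z` (centre its corner, radius `L^k − 1`),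
any level `j`.  If `|u(∂p) − 1| ≤ θ` for all plaquettes and a block ball does not wrap (`2(L^k − 1) + 4 < |T^{(j)}|`), then `u^h` is `T`-small
on every bond with both ends in one `k`-block for any `T ≥ d(L^k − 1)θ` (`d = P.d − 1`; `dist1_centredGauge_le` block by block), and EVERY
composite transport `u^h(Γ^{(k)}_y)` is within `(d+1)(L^k − 1)T` of `1` (it reads intra-block bonds only, §1's `holCK_congr`; p33's
`norm_holCK_sub_one_le` for the field cut to them) — p27 gen 34's inline argument (v1.2 §7 of `BIJ88NeumannPropagatorSmallFieldSupDecay`),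
exported. [cite: BalabanImbrieJaffe1985, (7.3.1) p.326] -/
theorem smallField_blockGauge {k : ℕ} (hk : j + k ≤ P.m + P.K) (U : GaugeField P j U1) {θ : ℝ} (hθ : 0 ≤ θ)
    (hplaq : ∀ p : Balaban1983to89.Plaq P j, ‖toC (plaqHol U p) - 1‖ ≤ θ) (hR : 2 * (P.L ^ k - 1) + 4 < P.sitesPerDir j)
    {T : ℝ} (hT : ((P.d - 1 : ℕ) : ℝ) * ((P.L : ℝ) ^ k - 1) * θ ≤ T) :
    (∀ b : PBond P j, blkIter k b.src = blkIter k b.tgt →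
        ‖toC (gaugeAct (fun z => centredGauge U (cornerIter k (blkIter k z)) (P.L ^ k - 1) z) U b) - 1‖ ≤ T) ∧
      ∀ y : Balaban1983to89.Site P j,
        ‖holCK (gaugeAct (fun z => centredGauge U (cornerIter k (blkIter k z)) (P.L ^ k - 1) z) U) k y - 1‖
          ≤ P.d * ((P.L : ℝ) ^ k - 1) * T := by
  set R : ℕ := P.L ^ k - 1 with hRdef
  set h : GaugeTransf P j U1 := fun z => centredGauge U (cornerIter k (blkIter k z)) R z with hh
  have hL1 : (1 : ℝ) < P.L := B1RG242Torus.one_lt_cast_L P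
  have hcast : ((R : ℕ) : ℝ) = (P.L : ℝ) ^ k - 1 := by
    rw [hRdef, Nat.cast_sub (Nat.one_le_pow _ _ P.L_pos), Nat.cast_pow, Nat.cast_one]
  have hT0 : 0 ≤ T := by
    refine le_trans (mul_nonneg (mul_nonneg (Nat.cast_nonneg _) ?_) hθ) hT
    have : (1 : ℝ) ≤ (P.L : ℝ) ^ k := one_le_pow₀ hL1.le
    linarith
  have hplaq' : ∀ p : Balaban1983to89.Plaq P j, dist1 (plaqHol U p) ≤ θ := fun p => by
    rw [dist1_eq_norm_toC_sub_one]; exact hplaq p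
  -- every bond with both ends in one `k`-block is `T`-small for `u^h`: it is the bond of the block's own axially gauged field
  have hbond : ∀ b : PBond P j, blkIter k b.src = blkIter k b.tgt → ‖toC (gaugeAct h U b) - 1‖ ≤ T := by
    intro b hb
    set x₀ : Balaban1983to89.Site P j := cornerIter k (blkIter k b.src) with hx₀
    have e : gaugeAct h U b = gaugeAct (centredGauge U x₀ R) U ⟨b.src, b.dir⟩ := by
      show h b.src * U b * (h b.tgt)⁻¹ = centredGauge U x₀ R b.src * U b * (centredGauge U x₀ R b.tgt)⁻¹
      simp only [hh, hx₀, hb]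
    have hz : supDist x₀ b.src ≤ R :=
      supDist_le_of_blkIter_eq hk (by rw [hx₀, blkIter_cornerIter k hk])
    have h2 := dist1_centredGauge_le U hθ hplaq' x₀ hR b.src hz b.dir
    rw [dist1_eq_norm_toC_sub_one] at h2
    rw [e]
    refine h2.trans (le_trans ?_ hT)
    have hz' : (supDist x₀ b.src : ℝ) ≤ (P.L : ℝ) ^ k - 1 := by rw [← hcast]; exact_mod_cast hz
    exact mul_le_mul_of_nonneg_right (mul_le_mul_of_nonneg_left hz' (Nat.cast_nonneg _)) hθ
  refine ⟨hbond, fun y => ?_⟩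
  -- the composite transports of `u^h` read only intra-block bonds: cut the field to them
  set V : GaugeField P j U1 := fun b => if blkIter k b.src = blkIter k b.tgt then gaugeAct h U b else 1 with hV
  have hVb : ∀ b : PBond P j, ‖toC (V b) - 1‖ ≤ T := fun b => by
    by_cases hb : blkIter k b.src = blkIter k b.tgt
    · have h1 : V b = gaugeAct h U b := by simp only [hV]; exact if_pos hb
      rw [h1]; exact hbond b hb
    · have h1 : V b = 1 := by simp only [hV]; exact if_neg hb
      rw [h1, toC_one, sub_self, norm_zero]; exact hT0
  have hcongr : holCK (gaugeAct h U) k y = holCK V k y :=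
    holCK_congr k hk y fun b hb1 hb2 => by
      have h1 : V b = gaugeAct h U b := by simp only [hV]; exact if_pos (hb1.trans hb2.symm)
      rw [h1]
  rw [hcongr]
  exact norm_holCK_sub_one_le hT0 hVb k y

/-- **THE KERNEL DECAY OF THE REGION NEUMANN PROPAGATORS UNDER (7.3.1) WITH A THRESHOLD DEPENDING ON `(d, L^k)` ONLY, FOR EVERY BLOCK
UNION** — uniform in the region and the volume: there are `t₀, c₀ > 0` depending on `(d, a)` only such that for every volume with `P.d = d`
and more than two `k`-blocks per direction (`2(L^k − 1) + 4 < |T|`), every `1 ≤ k ≤ m + K`, every `U(1)` field with `|u(∂p) − 1| ≤ θ` for all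
plaquettes, every `T ≥ (d−1)(L^k − 1)θ` with `2(L^k−1)L^k·d·T² + 2(d(L^k−1)T)² ≤ 1/2`, EVERY union `Ω` of `k`-blocks and all `x, y`:
`‖G_k(Ω,u;x,y)‖ ≤ c₀(L^kε)²e^{−t₀|x−y|_∞/L^k}` — §3 with the enclosing ball REMOVED (the companion file's `decay_kernel_smallField_region` for
`u^h` in the blockwise centred gauge, whose hypotheses `smallField_blockGauge` delivers on the whole torus, and the gauge invariance of the
modulus of the kernel). [cite: BalabanImbrieJaffe1985, (7.3.1)–(7.3.2) p.326] -/
theorem decay_kernel_smallPlaquette_region_uniform (d : ℕ) {a : ℝ} (ha : 0 < a) :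
    ∃ t₀ c₀ : ℝ, 0 < t₀ ∧ 0 < c₀ ∧ ∀ (P : Params), P.d = d →
      ∀ k : ℕ, 1 ≤ k → k ≤ P.m + P.K → 2 * (P.L ^ k - 1) + 4 < P.sitesPerDir 0 →
      ∀ (U : GaugeField P 0 U1) (θ : ℝ), 0 ≤ θ →
        (∀ p : Balaban1983to89.Plaq P 0, ‖toC (plaqHol U p) - 1‖ ≤ θ) →
        ∀ (T : ℝ), ((P.d - 1 : ℕ) : ℝ) * ((P.L : ℝ) ^ k - 1) * θ ≤ T →
          2 * (((P.L : ℝ) ^ k - 1) * (P.L : ℝ) ^ k) * P.d * T ^ 2 + 2 * (P.d * ((P.L : ℝ) ^ k - 1) * T) ^ 2 ≤ 1 / 2 →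
        ∀ (Ω : Finset (Balaban1983to89.Site P 0)), IsBlockUnion k Ω →
          ∀ x y : Balaban1983to89.Site P 0,
            ‖gBox (B1RG242Torus.α P a k * (P.L : ℝ) ^ (k * P.d)) P.eps⁻¹ U k Ω x y‖ ≤
              c₀ * P.spacing k ^ 2 * Real.exp (-(t₀ * (supDist x y : ℝ) / (P.L : ℝ) ^ k)) := by
  obtain ⟨t₀, c₀, ht₀, hc₀, H⟩ := decay_kernel_smallField_region d ha
  refine ⟨t₀, c₀, ht₀, hc₀, ?_⟩
  intro P hPd k hk1 hk hR U θ hθ hplaq T hT hsmall Ω hΩ x y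
  have hk0 : 0 + k ≤ P.m + P.K := by omega
  have hL1 : (1 : ℝ) < P.L := B1RG242Torus.one_lt_cast_L P
  have hα : 0 < B1RG242Torus.α P a k := mul_pos (B1.aSeq_pos ha hL1 hk1) (inv_pos.2 (pow_pos (P.spacing_pos k) 2))
  have ha' : 0 < B1RG242Torus.α P a k * (P.L : ℝ) ^ (k * P.d) := mul_pos hα (pow_pos P.cast_L_pos _)
  have hc : P.eps⁻¹ ≠ 0 := inv_ne_zero P.eps_pos.ne'
  obtain ⟨hbond, htree⟩ := smallField_blockGauge hk0 U hθ hplaq hR hT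
  set h : GaugeTransf P 0 U1 := fun z => centredGauge U (cornerIter k (blkIter k z)) (P.L ^ k - 1) z with hh
  have hdec := H P hPd k hk1 hk Ω hΩ (gaugeAct h U) T (P.d * ((P.L : ℝ) ^ k - 1) * T) (fun b _ hb => hbond b hb) (fun z _ => htree z)
    hsmall x y
  rw [gBox_gaugeAct_apply hk0 hc ha' h U hΩ x y, norm_mul, norm_mul, norm_toC, one_mul, RCLike.norm_conj, norm_toC, mul_one] at hdec
  exact hdec

/-- **THE COVARIANT-DERIVATIVE MEMBER UNDER (7.3.1) WITH A THRESHOLD DEPENDING ON `(d, L^k)` ONLY, FOR EVERY BLOCK UNION**, same data: for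
every bond `b ∈ Ω*` and every `y`, `‖ε⁻¹(u_bG_k(Ω,u;b₊,y) − G_k(Ω,u;b₋,y))‖ ≤ c₁(L^kε)e^{−t₀|y−b₊|_∞/L^k}`, `t₀, c₁ > 0` depending on `(d, a)`
only — §3's member with the enclosing ball removed (the companion file's `decay_covD_kernel_smallField_region` for `u^h` in the blockwise
centred gauge, and §2's gauge invariance of the modulus of the covariant derivative of the kernel).
[cite: BalabanImbrieJaffe1985, (7.3.1)–(7.3.2) p.326] -/
theorem decay_covD_kernel_smallPlaquette_region_uniform (d : ℕ) {a : ℝ} (ha : 0 < a) :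
    ∃ t₀ c₁ : ℝ, 0 < t₀ ∧ 0 < c₁ ∧ ∀ (P : Params), P.d = d →
      ∀ k : ℕ, 1 ≤ k → k ≤ P.m + P.K → 2 * (P.L ^ k - 1) + 4 < P.sitesPerDir 0 →
      ∀ (U : GaugeField P 0 U1) (θ : ℝ), 0 ≤ θ →
        (∀ p : Balaban1983to89.Plaq P 0, ‖toC (plaqHol U p) - 1‖ ≤ θ) →
        ∀ (T : ℝ), ((P.d - 1 : ℕ) : ℝ) * ((P.L : ℝ) ^ k - 1) * θ ≤ T →
          2 * (((P.L : ℝ) ^ k - 1) * (P.L : ℝ) ^ k) * P.d * T ^ 2 + 2 * (P.d * ((P.L : ℝ) ^ k - 1) * T) ^ 2 ≤ 1 / 2 →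
        ∀ (Ω : Finset (Balaban1983to89.Site P 0)), IsBlockUnion k Ω →
          ∀ b ∈ starB Ω, ∀ y : Balaban1983to89.Site P 0,
            ‖covD P.eps⁻¹ (cfg U) (fun x => gBox (B1RG242Torus.α P a k * (P.L : ℝ) ^ (k * P.d)) P.eps⁻¹ U k Ω x y) b‖ ≤
              c₁ * P.spacing k * Real.exp (-(t₀ * (supDist y b.tgt : ℝ) / (P.L : ℝ) ^ k)) := by
  obtain ⟨t₀, c₁, ht₀, hc₁, H⟩ := decay_covD_kernel_smallField_region d ha
  refine ⟨t₀, c₁, ht₀, hc₁, ?_⟩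
  intro P hPd k hk1 hk hR U θ hθ hplaq T hT hsmall Ω hΩ b hb y
  have hk0 : 0 + k ≤ P.m + P.K := by omega
  have hL1 : (1 : ℝ) < P.L := B1RG242Torus.one_lt_cast_L P
  have hα : 0 < B1RG242Torus.α P a k := mul_pos (B1.aSeq_pos ha hL1 hk1) (inv_pos.2 (pow_pos (P.spacing_pos k) 2))
  have ha' : 0 < B1RG242Torus.α P a k * (P.L : ℝ) ^ (k * P.d) := mul_pos hα (pow_pos P.cast_L_pos _)
  have hc : P.eps⁻¹ ≠ 0 := inv_ne_zero P.eps_pos.ne'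
  obtain ⟨hbond, htree⟩ := smallField_blockGauge hk0 U hθ hplaq hR hT
  set h : GaugeTransf P 0 U1 := fun z => centredGauge U (cornerIter k (blkIter k z)) (P.L ^ k - 1) z with hh
  have hdec := H P hPd k hk1 hk Ω hΩ (gaugeAct h U) T (P.d * ((P.L : ℝ) ^ k - 1) * T) (fun b _ hb => hbond b hb) (fun z _ => htree z)
    hsmall b hb y
  rw [norm_covD_gBox_gaugeAct hk0 hc ha' h U hΩ b y] at hdec
  exact hdec

end Uniform

end

end Literature.MathematicalPhysics.QuantumFieldTheory.BalabanImbrieJaffe1984to88.BIJ88NeumannPropagatorSmallPlaquetteRegion
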